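import Literature.Combinatorics.Optimization.SosConeSemidefiniteExtensionDegree
import Literature.Combinatorics.Optimization.HornMatrix
import HarnessLib

/-!
# The semidefinite extension degree of the copositive cone is at least `k` (Averkov 2019, Cor. 16)

G. Averkov, *Optimal size of linear matrix inequalities in semidefinite approaches to polynomial
optimization*, SIAM J. Appl. Algebra Geom. **3** (2019) = arXiv:1806.08656 [cite: Averkov2019] (held:
`paper:arxiv-1806.08656`, page locators of that text). Everything here is PROVED; no facts are asserted.

**Corollary 16 (p06), the lower bound**: "One has `sxd(CP_k) = sxd(CP_k^*) ≥ k`", where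
`CP_k = {A ∈ S^k : xᵀAx ≥ 0 for all x ∈ ℝ^k_+}` is the cone of copositive `k × k` matrices — typed for the
tree's `IsCopositive` (`MotzkinStrausCopositive.lean`; `xᵀAx ≥ 0` for entrywise nonnegative `x`, symmetry not
imposed) as `copositiveCone k`: **`not_hasBlockPsdLift_copositiveCone`** — `CP_k` has no `(S^K_+)^m`-lift for
`K < k`, whatever `m` ("the expressive power of LMIs of size `< k` does not suffice for copositive programming
of order `k`"), and `le_of_hasBlockPsdLift_copositiveCone`.

Proof as printed (§5, p13): the linear map `A ↦ f_A`, `f_A(x_1, …, x_{k-1}) = (x,1)ᵀA(x,1)` sends `CP_k` into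
`P_{k-1,2}(ℝ^{k-1}_+)` and the psd rank-one matrices `ccᵀ ∈ CP_k` onto the squares of `ℝ[x]_1`, so Corollary 3
(`not_hasBlockPsdLift_of_sq_mem'` of `SosConeSemidefiniteExtensionDegree.lean`, with `n = k − 1`, `d = 1`,
`X = ℝ^{k-1}_+`, `binom(k-1+1, k-1) = k`) applies to the image. Here `A ↦ f_A` is the Gram map
`SosCone.gramMap (k-1) 1` of that file (monomials of degree `≤ 1` = `1, x_1, …, x_{k-1}`), after re-indexing
`Fin k ≃ Fin |{α : |α| ≤ 1}|`; Averkov's bijectivity of `A ↦ f_A` on symmetric matrices is not needed for the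
lower bound.

Not here: the dual statement `sxd(CP_k^*) ≥ k` for the completely positive cone ((2.2), lifts of dual cones),
and the equality `sxd(CP_k) = k` for `k ≤ 4` (Diananda / Maxfield–Minc: `CP_k = S^k_+ + N^k_+` for `k ≤ 4`,
with Lemma 31); "the exact values `sxd(CP_k)` for `k > 4` are left undetermined. In fact, it is not even known
if these values are finite" (p06).
-/

noncomputable section

open Finset Matrix MvPolynomial
open scoped MatrixOrder

namespace Literature.Combinatorics.Optimization

open SosCone
open Literature.Combinatorics.Optimization.MotzkinStrausCopositive (IsCopositive)

/-- **The copositive cone `CP_k`** of real `k × k` matrices `A` with `xᵀAx ≥ 0` for all `x ∈ ℝ^k_+` (the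
tree's `IsCopositive`; Averkov takes `A` symmetric, which does not change the quadratic forms).
[cite: Averkov2019, §2.1 (p06, `CP_k`)] -/
def copositiveCone (k : ℕ) : Set (Matrix (Fin k) (Fin k) ℝ) := {A | IsCopositive A}

/-- Membership in `CP_k`. [cite: Averkov2019, §2.1 (p06)] -/
theorem mem_copositiveCone_iff {k : ℕ} {A : Matrix (Fin k) (Fin k) ℝ} :
    A ∈ copositiveCone k ↔ IsCopositive A := Iff.rfl

namespace CopositiveSxd

/-- Evaluation of the monomial `x^β`. [folklore] -/
private theorem eval_mono {n d : ℕ} (x : Fin n → ℝ) (β : Idx n d) :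
    eval x (mono β) = momentVector d x β := by
  rw [mono, eval_monomial, Finsupp.prod_fintype _ _ (fun _ => pow_zero _), one_mul]
  simp [momentVector, Idx.toFinsupp]

/-- **`f_A(x) = v(x)ᵀ A v(x)`**: the Gram map evaluates to the quadratic form of `A` at the moment vector
(for `d = 1`: `f_A(x) = (x,1)ᵀA(x,1)`). [cite: Averkov2019, proof of Cor. 6 and Cor. 16 (p13, `q_A`, `f_A`)] -/
theorem eval_gramMap {n d : ℕ} (A : Matrix (Fin (Fintype.card (Idx n d))) (Fin (Fintype.card (Idx n d))) ℝ)
    (x : Fin n → ℝ) :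
    eval x (gramMap n d A) =
      (fun i => momentVector d x ((Fintype.equivFin (Idx n d)).symm i)) ⬝ᵥ
        A *ᵥ fun i => momentVector d x ((Fintype.equivFin (Idx n d)).symm i) := by
  simp only [gramMap, LinearMap.coe_mk, AddHom.coe_mk, map_sum, smul_eval, map_mul, eval_mono, dotProduct,
    mulVec, mul_sum]
  exact sum_congr rfl fun i _ => sum_congr rfl fun j _ => by ring

/-- The moment vector of an entrywise nonnegative point is entrywise nonnegative. [folklore] -/
private theorem momentVector_nonneg {n d : ℕ} {x : Fin n → ℝ} (hx : ∀ i, 0 ≤ x i) (β : Idx n d) :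
    0 ≤ momentVector d x β :=
  prod_nonneg fun i _ => pow_nonneg (hx i) _

/-- `ccᵀ` is copositive (indeed psd: `xᵀccᵀx = (cᵀx)²`). [folklore] -/
private theorem isCopositive_vecMulVec {ι : Type*} [Fintype ι] (c : ι → ℝ) : IsCopositive (vecMulVec c c) := by
  intro x _
  have hL : x ⬝ᵥ vecMulVec c c *ᵥ x = ∑ i, ∑ j, x i * c i * (x j * c j) := by
    simp only [dotProduct, mulVec, vecMulVec_apply, mul_sum]
    exact sum_congr rfl fun i _ => sum_congr rfl fun j _ => by ring
  rw [hL, ← sum_mul_sum, ← sq]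
  exact sq_nonneg _

/-- The positive orthant has non-empty interior in `ℝⁿ`. [folklore] -/
private theorem interior_orthant_nonempty (n : ℕ) :
    (interior {x : Fin n → ℝ | ∀ i, 0 ≤ x i}).Nonempty := by
  have hopen : IsOpen {x : Fin n → ℝ | ∀ i, 0 < x i} := by
    rw [Set.setOf_forall]
    exact isOpen_iInter_of_finite fun i => isOpen_lt continuous_const (continuous_apply i)
  have hsub : {x : Fin n → ℝ | ∀ i, 0 < x i} ⊆ {x : Fin n → ℝ | ∀ i, 0 ≤ x i} :=
    fun x hx i => le_of_lt (hx i)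
  refine ⟨fun _ => 1, interior_mono hsub ?_⟩
  rw [hopen.interior_eq]
  exact fun i => one_pos

end CopositiveSxd

open CopositiveSxd

/-- **Averkov 2019, Corollary 16 (lower bound): `sxd(CP_k) ≥ k`** — the copositive cone `CP_k` has no
`(S^K_+)^m`-lift with `K < k`, for any number `m` of blocks. Proof as printed (p13): `A ↦ f_A = (x,1)ᵀA(x,1)`
maps `CP_k` into `P_{k-1,2}(ℝ^{k-1}_+)` and `ccᵀ ↦ (cᵀ(x,1))²` reaches every square of `ℝ[x]_1`, so Cor. 3
applies with `binom((k-1)+1, k-1) = k`. [cite: Averkov2019, Cor. 16 (p06), proof §5 (p13)] -/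
theorem not_hasBlockPsdLift_copositiveCone {k K : ℕ} (hK : K < k) (m : ℕ) :
    ¬ HasBlockPsdLift (copositiveCone k) K m := by
  classical
  intro hlift
  obtain ⟨n, rfl⟩ : ∃ n, k = n + 1 := ⟨k - 1, by omega⟩
  -- re-index `Fin (n+1)` by the monomials of degree `≤ 1` in `n` variables
  set N := Fintype.card (Idx n 1) with hN
  have hNk : N = n + 1 := by rw [hN, card_Idx]; simp
  let ε : Fin N ≃ Fin (n + 1) := finCongr hNk
  let e := Fintype.equivFin (Idx n 1)
  let ρ : Matrix (Fin (n + 1)) (Fin (n + 1)) ℝ ≃ₗ[ℝ] Matrix (Fin N) (Fin N) ℝ :=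
    Matrix.reindexLinearEquiv ℝ ℝ ε.symm ε.symm
  have hρ : ∀ A, ρ A = A.submatrix ε ε := fun A => rfl
  -- the cone `f(CP_k) ⊆ ℝ[x]_2`, `f_A = v(x)ᵀ (ρ A) v(x)`
  set C : Set (MvPolynomial (Fin n) ℝ) := (gramMap n 1 ∘ₗ ρ.toLinearMap) '' copositiveCone (n + 1) with hC
  have hClift : HasBlockPsdLift C K m := hlift.image _
  refine not_hasBlockPsdLift_of_sq_mem' (d := 1) (X := {x : Fin n → ℝ | ∀ i, 0 ≤ x i})
    (interior_orthant_nonempty n) (C := C) ?_ ?_ ?_ (by rw [← hN]; omega) hClift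
  · -- positive scaling
    rintro _ ⟨A, hA, rfl⟩ r hr
    refine ⟨r • A, fun x hx => ?_, by rw [map_smul]⟩
    rw [smul_mulVec, dotProduct_smul, smul_eq_mul]
    exact mul_nonneg hr.le (hA x hx)
  · -- `f_A ∈ P_{n,2}(ℝ^n_+)`
    rintro _ ⟨A, hA, rfl⟩
    refine ⟨totalDegree_gramMap_le _, fun x hx => ?_⟩
    rw [LinearMap.comp_apply, eval_gramMap]
    have hA' : IsCopositive (ρ A) := by
      rw [hρ]
      exact (HornMatrix.isCopositive_submatrix_iff ε).2 hA
    exact hA' _ fun i => momentVector_nonneg hx _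
  · -- squares of `ℝ[x]_1` are the images of the rank-one psd matrices `ccᵀ`
    intro q hq
    let c : Fin N → ℝ := fun i => coeffVec n 1 q (e.symm i)
    refine ⟨ρ.symm (vecMulVec c c), ?_, ?_⟩
    · change IsCopositive (ρ.symm (vecMulVec c c))
      have : ρ.symm (vecMulVec c c) = (vecMulVec c c).submatrix ε.symm ε.symm := rfl
      rw [this]
      exact (HornMatrix.isCopositive_submatrix_iff ε.symm).2 (isCopositive_vecMulVec c)
    · rw [LinearMap.comp_apply, LinearEquiv.coe_toLinearMap, LinearEquiv.apply_symm_apply]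
      let B : Matrix (Fin 1) (Fin N) ℝ := fun _ i => c i
      have hB : vecMulVec c c = Bᵀ * B := by
        ext i j
        simp [B, vecMulVec_apply, Matrix.mul_apply]
      rw [hB, gramMap_transpose_mul_self, Fin.sum_univ_one]
      have : (fun β => B 0 (Fintype.equivFin (Idx n 1) β)) = coeffVec n 1 q := funext fun β => by
        simp only [B, c, e, Equiv.symm_apply_apply]
      rw [this, ofVec_coeffVec hq]

/-- **Averkov 2019, Corollary 16: `sxd(CP_k) ≥ k`** — every `(S^K_+)^m`-lift of the copositive cone has
blocks of size `K ≥ k`. [cite: Averkov2019, Cor. 16 (p06)] -/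
theorem le_of_hasBlockPsdLift_copositiveCone {k K m : ℕ} (h : HasBlockPsdLift (copositiveCone k) K m) :
    k ≤ K := by
  by_contra hlt
  exact not_hasBlockPsdLift_copositiveCone (not_le.1 hlt) m h

/-- **`sxd(CP_k) ≥ k` as a lower bound on the least block size**: `k` is a lower bound of the set of block
sizes `K` admitting an `(S^K_+)^m`-lift of `CP_k` (whether this set is non-empty for `k > 4`, i.e. whether
`sxd(CP_k) < ∞`, "is not even known", p06). [cite: Averkov2019, Cor. 16 (p06)] -/
theorem mem_lowerBounds_blockSize_hasBlockPsdLift_copositiveCone (k : ℕ) :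
    k ∈ lowerBounds {K : ℕ | ∃ m : ℕ, HasBlockPsdLift (copositiveCone k) K m} := by
  rintro K ⟨m, hm⟩
  exact le_of_hasBlockPsdLift_copositiveCone hm

end Literature.Combinatorics.Optimization

end
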